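import Summits.QuantumFields.YangMills.Theorems.AlphaInputsT3ACv4RecordConstants
import Literature.MathematicalPhysics.QuantumFieldTheory.Balaban1985CMP102.Binders
import HarnessLib

/-!
# `AlphaInputsT3ACRecordStepConstants` — THE STEP-CONSTANT SLOTS OF THE (α) RECORD ARE FREE AT THE SERVED RECORD: (E-mono) the `norm35` row is monotone in its
# volume∕Jacobian constants `cv`, `cJ35`; (E-prof) the record-constants lemmas of the lineage (`exists_alphaConsts_profile`, `exists_record_sizes_M₁_gamma0`) in an
# EDITION that also EXPORTS the seven step constants `c35 a35 cv cT aT cn cJT` of the seed unchanged and `cJ ≤ cJ35` for any prescribed `cJ ≥ 0`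

Cell `ym3-torus` (HUMAN RULING D-0037, YM ladder rung R3), width seat `ym3-torus-px8` (g17); ★★OWNER ym3-torus-plan g36 RECORD 17cq (2026-08-30T13:50:45Z) «at the SERVED
record of registry (O‴χₛ) `stub_selXsV4DataRows` the slot `𝔠.cJ35` of `AlphaDataAC.norm35` is NOT a free choice — `exists_alphaConsts_profile` RE-SETS `cJ35 := t(b₀) =
b₀²/(8MD) − A₀`, and the lineage's record lemmas export equalities for `b₀ p₀ B₃ M₁ κ₀ R₁ ρ cB C25` + the `C68` rows ONLY» and its two glue obligations (E-mono), (E-prof).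
`--supports stmt-QuantumFields-19936` (helper).  THEOREMS ONLY (def-free), sorry-free, standard axioms; registry ∕ binders ∕ `closes` untouched (J-FREEZE honoured);
CREDIT NOTHING — (α) data rows 0∕23 before and after.

WHAT IS PROVED (kernel; [folklore] bookkeeping on `Primitives.AlphaConsts` and `B10Eq35Norm.Norm35Model`).
* §1 (E-mono) ★`AlphaInputsT3AC.norm35StepAsCited_mono` — `Norm35StepAsCited P c a cv cJ → cv ≤ cv′ → cJ ≤ cJ′ → Norm35StepAsCited P c a cv′ cJ′` (structure map:
  `count_le`, `jac_le` composed with `mul_le_mul_of_nonneg_right` over `StepPieces.Zvol_nonneg`); `AlphaInputsT3AC.norm35StepAsCited_at_record` — the row at a record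
  `𝔠′` whose `c35 a35 cv` agree with the supplier's and whose `cJ35 ≥` the supplier's `cJ`.
* §2 (E-prof, profile) ★★`AlphaInputsT3AC.exists_alphaConsts_profile_steps (𝔠) (hcJ : 0 ≤ cJ)` — ✓`AlphaInputsT3AC.exists_alphaConsts_profile` (same record
  `{𝔠 with r₀ := (p₀−1)/2, cJ35 := t(b₀), C68 := max C68 c}`, threshold raised by `√(8·M·D·cJ)` so that `t(b₀) ≥ cJ`) WITH the extra conjuncts
  `𝔠′.c35 = 𝔠.c35 ∧ 𝔠′.a35 = 𝔠.a35 ∧ 𝔠′.cv = 𝔠.cv ∧ 𝔠′.cT = 𝔠.cT ∧ 𝔠′.aT = 𝔠.aT ∧ 𝔠′.cn = 𝔠.cn ∧ 𝔠′.cJT = 𝔠.cJT` (seven `rfl`s) `∧ cJ ≤ 𝔠′.cJ35`.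
* §3 (E-prof, served record) ★★`AlphaInputsT3AC.exists_record_sizes_M₁_gamma0_steps` — ✓`AlphaInputsT3AC.exists_record_sizes_M₁_gamma0` (the v4 closer's record lemma:
  exact profile, the three `C68`-sizes, `7L + 3 ≤ M₁`, the `γ₀`-tolerance row, `ρ ≤ ρ₀`) WITH `𝔠.M₁ = max 𝔠₀.M₁ (7L+3)` (so a seed with `7L + 3 ≤ M₁` keeps its `M₁`), the
  seven step-constant equalities to the SEED's, and `cJ ≤ 𝔠.cJ35`.
JUNCTION WITH THE B0∣_{U=1} DOSSIER (px8 g17 UNFILED draft v3 `B0FlatDraft.v3.px8g17.lean` 1460941a58ff854b, 19936 evidence #47; NOT imported — it is unfiled): seed the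
record with `M₁ ≥ 7L + 3` and step slots `(c35, a35, cv, cT, aT, cn, cJT) := (gamma2153 3 L, aT L, cvT L M₁, gamma2153 3 L, aT L, 9, 27 log L)` and take
`cJ := cJT L M₁`; then at the served record `𝔠′` of §3, row #13 is slot-exact (`logZT_row_of_fields`) and row #12 is `norm35StepAsCited_at_record` ∘ `norm35_row_of_fields'`.
HONEST SCOPE.  Bookkeeping about the lane's constants record; nothing of [Balaban1985UV3] is asserted or proved; rows #12∕#13, (O‴χₛ), `HistoryTailL` (19936), 19200, 20520,
`YM3TorusSU2` NOT proved; rung R3 = SU(2) YM₃ on T³ — NOT d = 4, NOT infinite volume, NOT a mass gap, NOT Clay.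
References: T. Bałaban, Commun. Math. Phys. 102 (1985) 255–275 [Balaban1985UV3] ((7) p.257, (35) p.265, (28) p.263, (68)–(71) p.273).
-/

set_option autoImplicit false

noncomputable section

namespace Summit.QuantumFields.YangMills.Theorems

open Literature.MathematicalPhysics.QuantumFieldTheory.Balaban1983to89
open Literature.MathematicalPhysics.QuantumFieldTheory.Balaban1983to89.B10 (TowerRun)
open Literature.MathematicalPhysics.QuantumFieldTheory.Balaban1983to89.B10SectAGathering (StepPieces)
open Literature.MathematicalPhysics.QuantumFieldTheory.Balaban1985CMP102.Binders (Norm35StepAsCited)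
open Literature.MathematicalPhysics.QuantumFieldTheory.Balaban1985CMP102.Setting
open Summit.QuantumFields.Balaban3D.Carriers
open Summit.QuantumFields.Balaban3D.Proofs.Primitives
open Summit.QuantumFields.Balaban3D.Proofs.Thresholds (Q0 Q0_pos)
open B7Prop2Explicit (C0 C0_pos)

/-! ## §1 (E-mono) The `norm35` row is monotone in `cv`, `cJ35` -/

section Mono

variable {T : TowerRun} {k : ℕ} {P : StepPieces T k}

/-- ★ **(E-mono)**: `Norm35StepAsCited P c a cv cJ` with `cv ≤ cv′`, `cJ ≤ cJ′` gives `Norm35StepAsCited P c a cv′ cJ′` — the same model data at every history, its two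
counts relaxed through `0 ≤ |Z_k(h)|` (`StepPieces.Zvol_nonneg`). [cite: Balaban1985UV3, (35) p.265] -/
theorem AlphaInputsT3AC.norm35StepAsCited_mono {c a cv cJ cv' cJ' : ℝ} (h : Norm35StepAsCited P c a cv cJ) (hcv : cv ≤ cv') (hcJ : cJ ≤ cJ') :
    Norm35StepAsCited P c a cv' cJ' := fun hh => by
  obtain ⟨M⟩ := h hh
  exact ⟨{ M with
    count_le := M.count_le.trans (mul_le_mul_of_nonneg_right hcv (P.Zvol_nonneg hh))
    jac_le := M.jac_le.trans (mul_le_mul_of_nonneg_right hcJ (P.Zvol_nonneg hh)) }⟩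

/-- **THE ROW AT THE SERVED RECORD**: a supplier's `norm35` row at `(𝔠₀.c35, 𝔠₀.a35, 𝔠₀.cv, cJ)` holds at every record `𝔠′` whose three slots agree with `𝔠₀`'s and whose
`cJ35 ≥ cJ` (the shape exported by §2–§3). [cite: Balaban1985UV3, (35) p.265] -/
theorem AlphaInputsT3AC.norm35StepAsCited_at_record {L N : ℕ} {𝔠₀ 𝔠' : AlphaConsts L N} {cJ : ℝ}
    (hrow : Norm35StepAsCited P 𝔠₀.c35 𝔠₀.a35 𝔠₀.cv cJ) (h35 : 𝔠'.c35 = 𝔠₀.c35) (ha : 𝔠'.a35 = 𝔠₀.a35) (hv : 𝔠'.cv = 𝔠₀.cv)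
    (hJ : cJ ≤ 𝔠'.cJ35) : Norm35StepAsCited P 𝔠'.c35 𝔠'.a35 𝔠'.cv 𝔠'.cJ35 := by
  rw [h35, ha, hv]
  exact AlphaInputsT3AC.norm35StepAsCited_mono hrow le_rfl hJ

end Mono

/-! ## §2 (E-prof) Records with a prescribed profile that KEEP the seven step constants and dominate a prescribed `cJ35` -/

section Profile

variable {L N : ℕ}

/-- ★★ **(E-prof), PROFILE EDITION** of ✓`AlphaInputsT3AC.exists_alphaConsts_profile`: for every record `𝔠` and every `cJ ≥ 0` there is `b₁ ≥ 0` such that for all `b₀ ≥ b₁`,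
`p₀ ≥ 3` and every `c` there is a record `𝔠′ = {𝔠 with r₀ := (p₀−1)/2, cJ35 := b₀²/(8MD) − A₀, C68 := max C68 c}` with `𝔠′.b₀ = b₀`, `𝔠′.p₀ = p₀`, `c ≤ 𝔠′.C68`, the
fields `B₃ M₁ κ₀ R₁ ρ cB C25` AND THE SEVEN STEP CONSTANTS `c35 a35 cv cT aT cn cJT` unchanged, and `cJ ≤ 𝔠′.cJ35` (threshold
`√(56M) + √(8M|A₀|D) + √(8MD·cJ)`). [cite: Balaban1985UV3, (7) p.257] -/
theorem AlphaInputsT3AC.exists_alphaConsts_profile_steps (𝔠 : AlphaConsts L N) {cJ : ℝ} (hcJ : 0 ≤ cJ) :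
    ∃ b₁ : ℝ, 0 ≤ b₁ ∧ ∀ (b₀ p₀ c : ℝ), b₁ ≤ b₀ → 3 ≤ p₀ →
      ∃ 𝔠' : AlphaConsts L N, 𝔠'.b₀ = b₀ ∧ 𝔠'.p₀ = p₀ ∧ c ≤ 𝔠'.C68 ∧ 𝔠.C68 ≤ 𝔠'.C68 ∧
        𝔠'.B₃ = 𝔠.B₃ ∧ 𝔠'.M₁ = 𝔠.M₁ ∧ 𝔠'.κ₀ = 𝔠.κ₀ ∧ 𝔠'.R₁ = 𝔠.R₁ ∧ 𝔠'.ρ = 𝔠.ρ ∧ 𝔠'.cB = 𝔠.cB ∧ 𝔠'.C25 = 𝔠.C25 ∧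
        (𝔠'.c35 = 𝔠.c35 ∧ 𝔠'.a35 = 𝔠.a35 ∧ 𝔠'.cv = 𝔠.cv ∧ 𝔠'.cT = 𝔠.cT ∧ 𝔠'.aT = 𝔠.aT ∧ 𝔠'.cn = 𝔠.cn ∧ 𝔠'.cJT = 𝔠.cJT) ∧
        cJ ≤ 𝔠'.cJ35 := by
  -- the constants of the `b₀`-equation (as in `exists_alphaConsts_profile`)
  have hL1 : (1 : ℝ) < L := by exact_mod_cast 𝔠.one_lt_L
  have hlog : 0 < Real.log (L : ℝ) / 2 := by have := Real.log_pos hL1; linarith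
  have hKc := AlphaInputsT3AC.Kc_pos 𝔠
  set M : ℝ := 4 * max (N : ℝ) 1 with hMdef
  set D : ℝ := 𝔠.Kc ^ 3 / (Real.log (L : ℝ) / 2) with hDdef
  set A₀ : ℝ := 𝔠.Alf - 𝔠.cJ35 with hA₀def
  have hM : 0 < M := by positivity
  have hD : 0 < D := by positivity
  refine ⟨Real.sqrt (M * 56) + Real.sqrt (8 * M * |A₀| * D) + Real.sqrt (8 * M * D * cJ), by positivity, fun b₀ p₀ c hb hp => ?_⟩
  have hs56 : 0 ≤ Real.sqrt (M * 56) := Real.sqrt_nonneg _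
  have hsA : 0 ≤ Real.sqrt (8 * M * |A₀| * D) := Real.sqrt_nonneg _
  have hsJ : 0 ≤ Real.sqrt (8 * M * D * cJ) := Real.sqrt_nonneg _
  have hb0 : 0 ≤ b₀ := by linarith
  have h56 : M * 56 ≤ b₀ ^ 2 := by
    have h := Real.sq_sqrt (show 0 ≤ M * 56 by positivity)
    nlinarith
  have hAJ : 8 * M * |A₀| * D + 8 * M * D * cJ ≤ b₀ ^ 2 := by
    have h1 := Real.sq_sqrt (show 0 ≤ 8 * M * |A₀| * D by positivity)
    have h2 := Real.sq_sqrt (show 0 ≤ 8 * M * D * cJ by positivity)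
    have h3 : Real.sqrt (8 * M * |A₀| * D) + Real.sqrt (8 * M * D * cJ) ≤ b₀ := by linarith
    have h4 : 0 ≤ Real.sqrt (8 * M * |A₀| * D) * Real.sqrt (8 * M * D * cJ) := mul_nonneg hsA hsJ
    nlinarith
  set t : ℝ := b₀ ^ 2 / (8 * M * D) - A₀ with htdef
  have h8MD : 0 < 8 * M * D := by positivity
  have htJ : cJ ≤ t := by
    have h1 : |A₀| + cJ ≤ b₀ ^ 2 / (8 * M * D) := by
      rw [le_div_iff₀ h8MD]; nlinarith
    have h2 : A₀ ≤ |A₀| := le_abs_self _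
    rw [htdef]; linarith
  have ht : 0 ≤ t := hcJ.trans htJ
  let 𝔠' : AlphaConsts L N :=
    { 𝔠 with
      r₀ := (p₀ - 1) / 2
      cJ35 := t
      C68 := max 𝔠.C68 c
      one_le_r₀ := by linarith
      cJ35_nonneg := ht
      C68_pos := lt_max_of_lt_left 𝔠.C68_pos }
  refine ⟨𝔠', ?_, ?_, le_max_right _ _, le_max_left _ _, rfl, rfl, rfl, rfl, rfl, rfl, rfl, ⟨rfl, rfl, rfl, rfl, rfl, rfl, rfl⟩, htJ⟩
  · -- the `b₀`-equation
    have hAlf' : 𝔠'.Alf = (𝔠.Cz + 𝔠.Cv) +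
        (𝔠.cv * ((Real.log (2 * Real.pi) + max |Real.log 𝔠.c35| |Real.log 𝔠.a35|) / 2) + t) + 𝔠.C₆ + (|𝔠.logσ₀| + (𝔠.dimg : ℝ)) * 3 := rfl
    have hAlf : 𝔠.Alf = (𝔠.Cz + 𝔠.Cv) +
        (𝔠.cv * ((Real.log (2 * Real.pi) + max |Real.log 𝔠.c35| |Real.log 𝔠.a35|) / 2) + 𝔠.cJ35) + 𝔠.C₆ + (|𝔠.logσ₀| + (𝔠.dimg : ℝ)) * 3 := rfl
    have hAlf'' : 𝔠'.Alf = A₀ + t := by rw [hAlf', hA₀def, hAlf]; ring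
    have hKc' : 𝔠'.Kc = 𝔠.Kc := rfl
    have hb' : 𝔠'.b₀ = Real.sqrt (4 * max (N : ℝ) 1 * max 56 (8 * (𝔠'.Alf * 𝔠'.Kc ^ 3 / (Real.log (L : ℝ) / 2)))) := rfl
    rw [hb', hAlf'', hKc']
    have hAt : A₀ + t = b₀ ^ 2 / (8 * M * D) := by rw [htdef]; ring
    have hKc0 : 𝔠.Kc ≠ 0 := hKc.ne'
    have hlog0 : Real.log (L : ℝ) / 2 ≠ 0 := hlog.ne'
    have hkey : 8 * ((A₀ + t) * 𝔠.Kc ^ 3 / (Real.log (L : ℝ) / 2)) = b₀ ^ 2 / M := by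
      have hlogL : Real.log (L : ℝ) ≠ 0 := (Real.log_pos hL1).ne'
      rw [hAt, hDdef]
      field_simp
    rw [← hMdef, hkey]
    have hmax : max 56 (b₀ ^ 2 / M) = b₀ ^ 2 / M := max_eq_right (by rw [le_div_iff₀ hM]; linarith)
    rw [hmax, mul_div_cancel₀ _ hM.ne', Real.sqrt_sq hb0]
  · -- the `p₀`-equation
    show 2 * ((p₀ - 1) / 2) + 1 = p₀
    ring

end Profile

/-! ## §3 (E-prof) The served record of the v4 closer KEEPS the seven step constants and dominates a prescribed `cJ35` -/

section Record

variable {L N : ℕ}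

/-- ★★ **(E-prof), SERVED-RECORD EDITION** of ✓`AlphaInputsT3AC.exists_record_sizes_M₁_gamma0`: for every seed `𝔠₀`, every `a₁ > 0` and every `cJ ≥ 0` there is `b₁`
such that for all `b₀ ≥ b₁`, `p₀ ≥ 3` and every tolerance `φ` positive on `(0, ∞)` there is a record `𝔠` with `𝔠.b₀ = b₀`, `𝔠.p₀ = p₀`, `𝔠.B₃ = 𝔠₀.B₃`, the three
`C68`-sizes, `7L + 3 ≤ 𝔠.M₁`, the `γ₀`-tolerance row, `𝔠.ρ ≤ 𝔠₀.ρ` — AND `𝔠.M₁ = max 𝔠₀.M₁ (7L+3)`, the seven step constants `c35 a35 cv cT aT cn cJT` EQUAL TO THE SEED's,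
`cJ ≤ 𝔠.cJ35`.  Same records as the original (big block enlarged, profile and `C68` by §2, `ρ` shrunk); the step slots are touched by none of the three moves.
[cite: Balaban1985UV3, (7) p.257, (28) p.263 and (68)–(71) p.273 (bookkeeping)] -/
theorem AlphaInputsT3AC.exists_record_sizes_M₁_gamma0_steps (𝔠₀ : AlphaConsts L N) {a₁ : ℝ} (ha₁ : 0 < a₁) {cJ : ℝ} (hcJ : 0 ≤ cJ) :
    ∃ b₁ : ℝ, 0 ≤ b₁ ∧ ∀ (b₀ p₀ : ℝ), b₁ ≤ b₀ → 3 ≤ p₀ → ∀ (φ : ℝ → ℝ), (∀ x : ℝ, 0 < x → 0 < φ x) →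
      ∃ 𝔠 : AlphaConsts L N, 𝔠.b₀ = b₀ ∧ 𝔠.p₀ = p₀ ∧ 𝔠.B₃ = 𝔠₀.B₃ ∧
        4 * 𝔠.B₃ * (L : ℝ) ^ 2 * avgWindowFactor L ≤ 𝔠.C68 ∧
        Real.exp (𝔠.p₀ - 1) ≤ 3 * C0 3 * 𝔠.C68 * (𝔠.b₀ * Q0 𝔠.p₀) ∧
        (𝔠.b₀ * Q0 𝔠.p₀) * (2 * (L : ℝ) ^ 2 * avgWindowFactor L) ^ 2 ≤ 3 * C0 3 * 𝔠.C68 * a₁ ^ 2 ∧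
        7 * L + 3 ≤ 𝔠.M₁ ∧
        𝔠.gamma0 ≤ ((φ 𝔠.C68 / (𝔠.b₀ * Q0 𝔠.p₀)) ^ 2) ^ 2 ∧
        𝔠.ρ ≤ 𝔠₀.ρ ∧
        𝔠.M₁ = max 𝔠₀.M₁ (7 * L + 3) ∧
        (𝔠.c35 = 𝔠₀.c35 ∧ 𝔠.a35 = 𝔠₀.a35 ∧ 𝔠.cv = 𝔠₀.cv ∧ 𝔠.cT = 𝔠₀.cT ∧ 𝔠.aT = 𝔠₀.aT ∧ 𝔠.cn = 𝔠₀.cn ∧ 𝔠.cJT = 𝔠₀.cJT) ∧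
        cJ ≤ 𝔠.cJ35 := by
  -- the seed with the big block enlarged
  let 𝔠₁ : AlphaConsts L N := { 𝔠₀ with M₁ := max 𝔠₀.M₁ (7 * L + 3), M₁_pos := lt_max_of_lt_left 𝔠₀.M₁_pos }
  have hM₁ : 7 * L + 3 ≤ 𝔠₁.M₁ := le_max_right _ _
  have hM₁' : 𝔠₁.M₁ = max 𝔠₀.M₁ (7 * L + 3) := rfl
  have hB₁ : 𝔠₁.B₃ = 𝔠₀.B₃ := rfl
  have hρ₁ : 𝔠₁.ρ = 𝔠₀.ρ := rfl
  obtain ⟨b₁, hb₁, h⟩ := AlphaInputsT3AC.exists_alphaConsts_profile_steps 𝔠₁ hcJ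
  refine ⟨b₁, hb₁, fun b₀ p₀ hb hp φ hφ => ?_⟩
  obtain ⟨𝔠, h1, h2, hc, -, hB, hM, -, -, hρ, -, -, hsteps, hJ⟩ := h b₀ p₀
    (max (4 * 𝔠₀.B₃ * (L : ℝ) ^ 2 * avgWindowFactor L)
      (max (Real.exp (p₀ - 1) / (3 * C0 3 * (b₀ * Q0 p₀)))
        ((b₀ * Q0 p₀) * (2 * (L : ℝ) ^ 2 * avgWindowFactor L) ^ 2 / (3 * C0 3 * a₁ ^ 2)))) hb hp
  have hb0 : 0 < b₀ := h1 ▸ 𝔠.b₀_pos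
  have hp0 : 0 < p₀ := h2 ▸ 𝔠.p₀_pos
  obtain ⟨s1, s2, s3⟩ := MinimiserPin.sizes_of_C68_ge (B₃ := 𝔠₀.B₃) (B := avgWindowFactor L) ha₁ hb0 hp0 hc
  -- the tolerance at the chosen `C68` and the prescribed profile
  have hT : 0 < ((φ 𝔠.C68 / (b₀ * Q0 p₀)) ^ 2) ^ 2 := by
    have := hφ _ 𝔠.C68_pos; have := Q0_pos hp0; positivity
  -- the shrunk record
  let 𝔠' : AlphaConsts L N :=
    { 𝔠 with ρ := min 𝔠.ρ (4 * Real.sqrt (((φ 𝔠.C68 / (b₀ * Q0 p₀)) ^ 2) ^ 2)), ρ_pos := lt_min 𝔠.ρ_pos (by positivity) }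
  have hb' : 𝔠'.b₀ = b₀ := h1
  have hp' : 𝔠'.p₀ = p₀ := h2
  have hC' : 𝔠'.C68 = 𝔠.C68 := rfl
  refine ⟨𝔠', hb', hp', hB.trans hB₁, ?_, ?_, ?_, ?_, ?_, ?_, ?_, ?_, hJ⟩
  · show 4 * 𝔠.B₃ * (L : ℝ) ^ 2 * avgWindowFactor L ≤ 𝔠.C68
    rw [hB, hB₁]; exact s1
  · rw [hb', hp', hC']; exact s2
  · rw [hb', hp', hC']; exact s3
  · show 7 * L + 3 ≤ 𝔠.M₁
    rw [hM]; exact hM₁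
  · rw [hb', hp', hC']
    exact RecordConstants.gamma0_le_of_rho_le 𝔠' hT.le (min_le_right _ _)
  · show min 𝔠.ρ _ ≤ 𝔠₀.ρ
    exact (min_le_left _ _).trans (hρ.trans hρ₁).le
  · show 𝔠.M₁ = max 𝔠₀.M₁ (7 * L + 3)
    rw [hM]
  · exact hsteps

end Record

/-! ## §4 (E-prof) A SEED with prescribed big-block size and step slots, and the served record with NO input record -/

section Seed

variable {L N : ℕ}

/-- **THE SEED**: from any record, one with PRESCRIBED big-block size `M₁ ≥ 1` and PRESCRIBED admissible step slots `(c35, a35, cv, cJ35, cT, aT, cn, cJT)` (`c35, cT > 0`,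
`cv, cJ35, cn, cJT ≥ 0`), all other fields kept (structure update; the six side conditions are exactly `AlphaConsts`' own). [cite: Balaban1985UV3, (7) p.257 + (35) p.265 + (65) p.273 (bookkeeping)] -/
theorem AlphaInputsT3AC.exists_alphaConsts_steps (𝔠₀ : AlphaConsts L N) {M₁ : ℕ} (hM₁ : 0 < M₁) {c35 a35 cv cJ35 cT aT cn cJT : ℝ}
    (h35 : 0 < c35) (hcv : 0 ≤ cv) (hcJ : 0 ≤ cJ35) (hT : 0 < cT) (hcn : 0 ≤ cn) (hcJT : 0 ≤ cJT) :
    ∃ 𝔠 : AlphaConsts L N, 𝔠.B₃ = 𝔠₀.B₃ ∧ 𝔠.ρ = 𝔠₀.ρ ∧ 𝔠.M₁ = M₁ ∧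
      (𝔠.c35 = c35 ∧ 𝔠.a35 = a35 ∧ 𝔠.cv = cv ∧ 𝔠.cT = cT ∧ 𝔠.aT = aT ∧ 𝔠.cn = cn ∧ 𝔠.cJT = cJT) ∧ 𝔠.cJ35 = cJ35 :=
  ⟨{ 𝔠₀ with
      M₁ := M₁, M₁_pos := hM₁, c35 := c35, a35 := a35, cv := cv, cJ35 := cJ35, cT := cT, aT := aT, cn := cn, cJT := cJT,
      c35_pos := h35, cv_nonneg := hcv, cJ35_nonneg := hcJ, cT_pos := hT, cn_nonneg := hcn, cJT_nonneg := hcJT },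
    rfl, rfl, rfl, ⟨rfl, rfl, rfl, rfl, rfl, rfl, rfl⟩, rfl⟩

/-- ★★★ **(E-prof) END TO END — THE SERVED RECORD CARRIES PRESCRIBED STEP SLOTS, WITH NO INPUT RECORD**: for `L > 1`, any `N`, `B₃ > 0`, `a₁ > 0`, any big-block size
`M₁ ≥ 7L + 3` and any admissible step slots `(c35, a35, cv, cT, aT, cn, cJT)` with a floor `cJ ≥ 0` for `cJ35`, there is `b₁` such that for all `b₀ ≥ b₁`, `p₀ ≥ 3` and every
tolerance `φ` positive on `(0, ∞)` some record has exact profile `(b₀, p₀)`, `B₃`, the three `C68`-sizes, the `γ₀`-tolerance row — AND `𝔠.M₁ = M₁`, the seven step slots AS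
PRESCRIBED, `cJ ≤ 𝔠.cJ35` (✓`exists_alphaConsts` ∘ `exists_alphaConsts_steps` ∘ `exists_record_sizes_M₁_gamma0_steps`; `max M₁ (7L+3) = M₁`).  This is the shape a B0 DEFINER
names its eight numbers in. [cite: Balaban1985UV3, (7) p.257, (28) p.263, (35) p.265 and (68)–(71) p.273 (bookkeeping)] -/
theorem AlphaInputsT3AC.exists_record_served_steps (hL : 1 < L) (N : ℕ) {B₃ a₁ : ℝ} (hB₃ : 0 < B₃) (ha₁ : 0 < a₁)
    {M₁ : ℕ} (hM₁ : 7 * L + 3 ≤ M₁) {c35 a35 cv cJ cT aT cn cJT : ℝ}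
    (h35 : 0 < c35) (hcv : 0 ≤ cv) (hcJ : 0 ≤ cJ) (hT : 0 < cT) (hcn : 0 ≤ cn) (hcJT : 0 ≤ cJT) :
    ∃ b₁ : ℝ, 0 ≤ b₁ ∧ ∀ (b₀ p₀ : ℝ), b₁ ≤ b₀ → 3 ≤ p₀ → ∀ (φ : ℝ → ℝ), (∀ x : ℝ, 0 < x → 0 < φ x) →
      ∃ 𝔠 : AlphaConsts L N, 𝔠.b₀ = b₀ ∧ 𝔠.p₀ = p₀ ∧ 𝔠.B₃ = B₃ ∧
        4 * 𝔠.B₃ * (L : ℝ) ^ 2 * avgWindowFactor L ≤ 𝔠.C68 ∧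
        Real.exp (𝔠.p₀ - 1) ≤ 3 * C0 3 * 𝔠.C68 * (𝔠.b₀ * Q0 𝔠.p₀) ∧
        (𝔠.b₀ * Q0 𝔠.p₀) * (2 * (L : ℝ) ^ 2 * avgWindowFactor L) ^ 2 ≤ 3 * C0 3 * 𝔠.C68 * a₁ ^ 2 ∧
        𝔠.gamma0 ≤ ((φ 𝔠.C68 / (𝔠.b₀ * Q0 𝔠.p₀)) ^ 2) ^ 2 ∧
        𝔠.M₁ = M₁ ∧
        (𝔠.c35 = c35 ∧ 𝔠.a35 = a35 ∧ 𝔠.cv = cv ∧ 𝔠.cT = cT ∧ 𝔠.aT = aT ∧ 𝔠.cn = cn ∧ 𝔠.cJT = cJT) ∧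
        cJ ≤ 𝔠.cJ35 := by
  obtain ⟨𝔠₀, hB₀⟩ := AlphaInputsT3AC.exists_alphaConsts hL N hB₃
  have hM₁pos : 0 < M₁ := by omega
  obtain ⟨𝔠₁, hB₁, -, hM₁', hsteps₁, -⟩ :=
    AlphaInputsT3AC.exists_alphaConsts_steps 𝔠₀ hM₁pos (cJ35 := cJ) h35 hcv hcJ hT hcn hcJT (a35 := a35) (aT := aT)
  obtain ⟨b₁, hb₁, h⟩ := AlphaInputsT3AC.exists_record_sizes_M₁_gamma0_steps 𝔠₁ ha₁ hcJ
  refine ⟨b₁, hb₁, fun b₀ p₀ hb hp φ hφ => ?_⟩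
  obtain ⟨𝔠, h1, h2, hB, s1, s2, s3, -, hγ, -, hM, hsteps, hJ⟩ := h b₀ p₀ hb hp φ hφ
  obtain ⟨e35, ea, ev, eT, eaT, en, eJT⟩ := hsteps
  obtain ⟨f35, fa, fv, fT, faT, fn, fJT⟩ := hsteps₁
  refine ⟨𝔠, h1, h2, hB.trans (hB₁.trans hB₀), s1, s2, s3, hγ, ?_,
    ⟨e35.trans f35, ea.trans fa, ev.trans fv, eT.trans fT, eaT.trans faT, en.trans fn, eJT.trans fJT⟩, hJ⟩
  rw [hM, hM₁']
  exact max_eq_left hM₁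

end Seed

end Summit.QuantumFields.YangMills.Theorems

end
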